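import Summits.BirchSwinnertonDyer.BirchSwinnertonDyer.Theorems.ManinLocalTwoThreeKummerCoverSubgroupTwo
import Summits.BirchSwinnertonDyer.BirchSwinnertonDyer.Theorems.ManinLocalTwoThreeShimuraQuotientLevelInstances
import Summits.BirchSwinnertonDyer.Rank1Residual.ManinAdditive.UDCKummerLineK
import Summits.BirchSwinnertonDyer.Rank1Residual.ManinAdditive.ShimuraKernel
import Summits.BirchSwinnertonDyer.BirchSwinnertonDyer.Theorems.ManinLocalTwoThreeUnboundedDenominatorsWeightAlgIntOfCDT
import Literature.NumberTheory.Automorphic.UnboundedDenominators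
import HarnessLib

/-!
# THE HALVING LINE: Unbounded Denominators on the `2`-DIVISION COVER of the optimal parametrisation — `2 ∣ c₀ ⟹ Λ₁(f) = 2Λ₀(f)`
# modulo ONE analytic witness law; hence C2 ⟸ CDT ∧ (halving witness) ∧ E-an-152b, with NO Kato / cusp facts and NO `2`-torsion hypothesis

Summit `BirchSwinnertonDyer`, route `ManinLocalTwoThree` (cell bsd-f2-manin), crux C2 `ManinOddAtFour` (stmt-BirchSwinnertonDyer-22967); lead p1 gen 18
(LEAD-MEMO v38, new line «halving_udc»).

THE IDEA.  Let `D` be a lattice-optimal `X₀(N)`-datum of a globally minimal `W` (`Λ_W = c·Λ₀(f)`) with `2 ∣ c`, `c' := c/2`.  The HALF POINT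
`Q(τ) := c'·E_f(τ) mod Λ_W ∈ E(ℂ)` (`2Q = φ(τ)`) moves under `γ ∈ Γ₀(N)` by the `2`-torsion point `c'·{∞,γ∞}_f mod Λ_W`, so every function of `Q`
is modular for EXACTLY the **halving cover group** `Γ^{(2)} := {γ ∈ Γ₀(N) : c·{∞,γ∞}_f ∈ 2Λ_W} = per⁻¹(2Λ₀(f))` — a normal, finite-index, TYPE-II
subgroup of `Γ₀(N)` (§1), which contains `Γ₁(N)` iff `Λ₁(f) ⊆ 2Λ₀(f)`, i.e. (at `4 ∣ N`) iff the Shimura quotient has INDEX `4`; otherwise it is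
NONCONGRUENCE (Kurth–Long, tree `typeIINoncongruence_holds`; §2).  The parameter `t(Q(τ)) = −x/y(Q)` has `q`-expansion `exp_W(c'·Σ aₙqⁿ/n) ∈ ℤ⟦q⟧`
(Honda at the INTEGER `c'`, tree `exists_int_coeff_formalExp_subst_lSeriesLog`), so a pole-cleared multiple `F = t(Q)·B_d·f^a·Δ^m` is a holomorphic
modular form for `Γ^{(2)}` with algebraic-integer coefficients — the **halving witness** (§3, the one OPEN analytic stub, shaped exactly like p2's AN2₂
`UDCTwo.sqRootWitnessLaw` with the `σ`-square root replaced by `t(Q)`): Unbounded Denominators (CDT) then makes `Γ^{(2)}` congruence, i.e. INDEX `4`.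
So **`2 ∣ c₀ ⟹ Λ₁ = 2Λ₀` modulo CDT ∧ (halving witness)**, for EVERY optimal curve at `4 ∣ N` (§3), and **C2 ⟸ CDT ∧ (halving witness) ∧ E-an-152b**
(`ShimuraIndexNeFourAtFour`, a THEOREM at every cyclic-cuspidal-inertia level, §4) — no F♯, F★, F♮, CES, F-es-21♭K, no blindness, no rational `2`-torsion.
(p2's ℓ = 2 Kummer chain and LEAD's `FullTwoTorsion` are the three intermediate quadratic covers `per⁻¹(L_T) ⊇ Γ^{(2)}`, each defined over `ℚ(T)`; the
full `[2]`-cover is defined over `ℚ` and sees all of `E[2]` at once — which is why the kernel-generator vacuity of v26/v27 disappears.)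

* §1 `exists_halvingCoverSubgroup` — `Γ^{(2)}` as a subgroup of `SL₂(ℤ)` inside `Γ₀(N)`: finite index (four cosets), normal, contains trace `±2`.
* §2 `gamma1_le_halvingCover_iff_indexFour`, `halvingCover_noncongruence` — `Γ₁(N) ≤ Γ^{(2)} ⟺ Λ₁ = 2Λ₀` (at `4 ∣ N`); otherwise no `Γ(M) ≤ Γ^{(2)}`.
* §3 `indexFour_of_two_dvd_of_halvingWitness_of_UDW` — the UDC glue: halving witness ∧ UDW ∧ `2 ∣ c` ⟹ index `4`; `…_of_CDT_algInt`.
* §4 `maninOddAtFour_of_CDT_halvingWitnessLaw_indexNeFour : CDT → HalvingWitnessLaw → E-an-152b → C2` — the new 3-stub skeleton's composition.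

HONEST FRAMING: CONDITIONAL on the printed CDT fact, on the OPEN halving witness law (analytic, the port of the landed AN2₂ chain to `t(Q)`), and on E-an-152b
at the levels where it is not yet a theorem; C2, Manin's conjecture and BSD are NOT proved.  No definitions (subgroups are existential witnesses), no sorry.
[cite: KurthLong2008, Def. 16 and Prop. 18] [cite: CalegariDimitrovTang2025, Thm. 1.0.1 and Remarks 58–59] [cite: Honda1970, Thm. 9] [cite: Manin1972, Thm. 1.6]
-/

set_option autoImplicit false
-- lint-debt: the directory name repeats the summit name (sibling precedent `ManinLocalTwoThreeKummerCoverSubgroupTwo.lean`)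
set_option linter.dupNamespace false

noncomputable section

open scoped MatrixGroups ModularForm PeriodPair Manifold
open CongruenceSubgroup Complex
open WeierstrassCurve Literature.NumberTheory.EllipticCurves Literature.NumberTheory.EllipticCurves.ModularForms
open Summit.BirchSwinnertonDyer.Rank1Residual.ManinAdditive
open Summit.BirchSwinnertonDyer.Rank1Residual.ManinAdditive.UDCKummerLine
open Summit.BirchSwinnertonDyer.Rank1Residual.ManinAdditive.UDCKummerLineK
open Summit.BirchSwinnertonDyer.Rank1Residual.ManinAdditive.ShimuraKernel

namespace Summit.BirchSwinnertonDyer.BirchSwinnertonDyer.Theorems.ManinLocalTwoThree.Halving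

variable {W : WeierstrassCurve ℚ} [W.IsElliptic] [W.IsGloballyMinimal] {N : ℕ} [NeZero N]

/-! ## §1 The halving cover group `Γ^{(2)} = {γ ∈ Γ₀(N) : c·{∞,γ∞}_f ∈ 2Λ_W}` -/

/-- Four classes: every `x ∈ Λ_W` is `≡ iω₁ + jω₂ (mod 2Λ_W)` with `i, j ∈ {0,1}`. [folklore] -/
theorem exists_four_classes (L : PeriodPair) :
    ∀ x ∈ L.lattice, ∃ i j : ℕ, i < 2 ∧ j < 2 ∧ ∃ ν ∈ L.lattice, x - (i : ℂ) * L.ω₁ - (j : ℂ) * L.ω₂ = 2 * ν := by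
  intro x hx
  obtain ⟨m, n, rfl⟩ := PeriodPair.mem_lattice.mp hx
  have em' : m = 2 * (m / 2) + m % 2 := by omega
  have en' : n = 2 * (n / 2) + n % 2 := by omega
  have em : (m : ℂ) = 2 * ((m / 2 : ℤ) : ℂ) + ((m % 2 : ℤ) : ℂ) := by exact_mod_cast em'
  have en : (n : ℂ) = 2 * ((n / 2 : ℤ) : ℂ) + ((n % 2 : ℤ) : ℂ) := by exact_mod_cast en'
  have hν : ((m / 2 : ℤ) : ℂ) * L.ω₁ + ((n / 2 : ℤ) : ℂ) * L.ω₂ ∈ L.lattice := PeriodPair.mem_lattice.mpr ⟨m / 2, n / 2, rfl⟩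
  rcases Int.emod_two_eq_zero_or_one m with hm | hm <;> rcases Int.emod_two_eq_zero_or_one n with hn | hn <;>
    rw [hm] at em <;> rw [hn] at en
  · exact ⟨0, 0, by norm_num, by norm_num, _, hν, by rw [em, en]; push_cast; ring⟩
  · exact ⟨0, 1, by norm_num, by norm_num, _, hν, by rw [em, en]; push_cast; ring⟩
  · exact ⟨1, 0, by norm_num, by norm_num, _, hν, by rw [em, en]; push_cast; ring⟩
  · exact ⟨1, 1, by norm_num, by norm_num, _, hν, by rw [em, en]; push_cast; ring⟩

omit [W.IsElliptic] [W.IsGloballyMinimal] in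
/-- **The halving cover group.**  For any `X₀(N)`-datum `D`: `Γ^{(2)} = {γ ∈ Γ₀(N) : c·{∞,γ∞}_f ∈ 2Λ_W}` is a subgroup of `SL₂(ℤ)` inside `Γ₀(N)`, of
finite index (at most four cosets), normal in `Γ₀(N)` (Manin's homomorphism `cuspSymbol_mul_holds`), containing every element of trace `±2` (zero
discriminant ⟹ zero period).  It is the monodromy group of the `2`-division cover `{(τ, Q) : 2Q = φ(τ)}` of `X₀(N)`.
[cite: KurthLong2008, Def. 16 (type II; shape)] [cite: Manin1972, Prop. 1.4 / Thm. 1.6] -/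
theorem exists_halvingCoverSubgroup (D : ModularParametrizationData W N) :
    ∃ Γ : Subgroup SL(2, ℤ),
      (∀ γ : Gamma0 N, (γ : SL(2, ℤ)) ∈ Γ ↔ ∃ ν ∈ D.L.lattice, (D.c : ℂ) * cuspSymbol D.f γ = 2 * ν) ∧
      Γ ≤ Gamma0 N ∧ Γ.FiniteIndex ∧ (∀ g ∈ Gamma0 N, ∀ γ ∈ Γ, g * γ * g⁻¹ ∈ Γ) ∧
      (∀ γ ∈ Gamma0 N, (γ 0 0 + γ 1 1 = 2 ∨ γ 0 0 + γ 1 1 = -2) → γ ∈ Γ) := by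
  let Γ : Subgroup SL(2, ℤ) :=
    { carrier := {g | ∃ hg : g ∈ Gamma0 N, ∃ ν ∈ D.L.lattice, (D.c : ℂ) * cuspSymbol D.f ⟨g, hg⟩ = 2 * ν}
      one_mem' := by
        refine ⟨(Gamma0 N).one_mem, 0, zero_mem _, ?_⟩
        have : (⟨1, (Gamma0 N).one_mem⟩ : Gamma0 N) = 1 := rfl
        rw [this, cuspSymbol_one]; simp
      mul_mem' := by
        rintro g₁ g₂ ⟨hg₁, ν₁, hν₁, e₁⟩ ⟨hg₂, ν₂, hν₂, e₂⟩
        refine ⟨(Gamma0 N).mul_mem hg₁ hg₂, ν₁ + ν₂, add_mem hν₁ hν₂, ?_⟩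
        have : (⟨g₁ * g₂, (Gamma0 N).mul_mem hg₁ hg₂⟩ : Gamma0 N) = ⟨g₁, hg₁⟩ * ⟨g₂, hg₂⟩ := rfl
        rw [this, cuspSymbol_mul_holds, mul_add, e₁, e₂]; ring
      inv_mem' := by
        rintro g ⟨hg, ν, hν, e⟩
        refine ⟨(Gamma0 N).inv_mem hg, -ν, neg_mem hν, ?_⟩
        have : (⟨g⁻¹, (Gamma0 N).inv_mem hg⟩ : Gamma0 N) = ⟨g, hg⟩⁻¹ := rfl
        rw [this, cuspSymbol_inv, mul_neg, e]; ring }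
  have hmem : ∀ γ : Gamma0 N, (γ : SL(2, ℤ)) ∈ Γ ↔
      ∃ ν ∈ D.L.lattice, (D.c : ℂ) * cuspSymbol D.f γ = 2 * ν := fun γ ↦
    ⟨fun ⟨_, h⟩ ↦ h, fun h ↦ ⟨γ.2, h⟩⟩
  refine ⟨Γ, hmem, fun g hg ↦ hg.1, ?_, ?_, ?_⟩
  · -- FINITE INDEX: four cosets over `Γ₀(N)` (classes of `Λ_W / 2Λ_W`, representatives `ω₁, ω₂` are `c`-multiples of periods)
    have h₁ : D.L.ω₁ ∈ (D.L.lattice : Set ℂ) := D.L.ω₁_mem_lattice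
    have h₂ : D.L.ω₂ ∈ (D.L.lattice : Set ℂ) := D.L.ω₂_mem_lattice
    -- every lattice vector `c·{∞,γ∞}` lies in `Λ_W`; we need two group elements whose periods hit the classes of `ω₁, ω₂` — when they exist.
    -- In general the image of `γ ↦ c·{∞,γ∞}` is `c·Λ₀ ⊆ Λ_W`; we bound the index by the four classes of `c·Λ₀ / (c·Λ₀ ∩ 2Λ_W)` directly.
    classical
    -- the class map `Γ₀(N) → Λ_W/2Λ_W`-classes, realised through representatives in `Γ₀(N)` of each NONEMPTY class
    have hcl : ∀ γ : Gamma0 N, ∃ i j : ℕ, i < 2 ∧ j < 2 ∧ ∃ ν ∈ D.L.lattice,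
        (D.c : ℂ) * cuspSymbol D.f γ - (i : ℂ) * D.L.ω₁ - (j : ℂ) * D.L.ω₂ = 2 * ν := fun γ ↦
      exists_four_classes D.L _ (D.smul_periodLattice_le _ (cuspSymbol_mem_periodLattice D.f γ))
    -- choose, for each of the four classes, a representative in `Γ₀(N)` if the class is hit (else `1`)
    have hrep : ∀ p : Fin 2 × Fin 2, ∃ g : Gamma0 N, (∃ γ : Gamma0 N, ∃ ν ∈ D.L.lattice,
        (D.c : ℂ) * cuspSymbol D.f γ - ((p.1 : ℕ) : ℂ) * D.L.ω₁ - ((p.2 : ℕ) : ℂ) * D.L.ω₂ = 2 * ν) →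
        ∃ ν ∈ D.L.lattice, (D.c : ℂ) * cuspSymbol D.f g - ((p.1 : ℕ) : ℂ) * D.L.ω₁ - ((p.2 : ℕ) : ℂ) * D.L.ω₂ = 2 * ν := by
      intro p
      by_cases h : ∃ γ : Gamma0 N, ∃ ν ∈ D.L.lattice,
          (D.c : ℂ) * cuspSymbol D.f γ - ((p.1 : ℕ) : ℂ) * D.L.ω₁ - ((p.2 : ℕ) : ℂ) * D.L.ω₂ = 2 * ν
      · obtain ⟨γ, hγ⟩ := h; exact ⟨γ, fun _ ↦ hγ⟩
      · exact ⟨1, fun h' ↦ absurd h' h⟩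
    choose rep hrep using hrep
    have hcoset : ∀ γ : Gamma0 N, ∃ p : Fin 2 × Fin 2, ((rep p : SL(2, ℤ)))⁻¹ * (γ : SL(2, ℤ)) ∈ Γ := by
      intro γ
      obtain ⟨i, j, hi, hj, ν, hν, e⟩ := hcl γ
      set p : Fin 2 × Fin 2 := (⟨i, hi⟩, ⟨j, hj⟩) with hp
      obtain ⟨ν', hν', e'⟩ := hrep p ⟨γ, ν, hν, by rw [hp]; exact e⟩
      refine ⟨p, (hmem ((rep p)⁻¹ * γ)).mpr ⟨ν - ν', sub_mem hν hν', ?_⟩⟩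
      rw [cuspSymbol_mul_holds, cuspSymbol_inv]
      have e'' : (D.c : ℂ) * cuspSymbol D.f (rep p) - (i : ℂ) * D.L.ω₁ - (j : ℂ) * D.L.ω₂ = 2 * ν' := by rw [hp] at e'; exact e'
      linear_combination e - e''
    haveI : Finite (SL(2, ℤ) ⧸ Γ) := by
      refine Finite.of_surjective
        (fun q : (SL(2, ℤ) ⧸ Gamma0 N) × (Fin 2 × Fin 2) ↦ (QuotientGroup.mk (q.1.out * (rep q.2 : SL(2, ℤ))) : SL(2, ℤ) ⧸ Γ)) ?_
      intro q
      induction q using QuotientGroup.induction_on with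
      | H g =>
        obtain ⟨h, hh⟩ := QuotientGroup.mk_out_eq_mul (Gamma0 N) g
        obtain ⟨p, hδ⟩ := hcoset h⁻¹
        refine ⟨(QuotientGroup.mk g, p), ?_⟩
        show (QuotientGroup.mk ((QuotientGroup.mk g : SL(2, ℤ) ⧸ Gamma0 N).out * (rep p : SL(2, ℤ))) : SL(2, ℤ) ⧸ Γ) =
          QuotientGroup.mk g
        rw [QuotientGroup.eq, hh]
        have e : ((g : SL(2, ℤ)) * (h : SL(2, ℤ)) * (rep p : SL(2, ℤ)))⁻¹ * g =
            ((rep p : SL(2, ℤ)))⁻¹ * ((h⁻¹ : Gamma0 N) : SL(2, ℤ)) := by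
          rw [Subgroup.coe_inv]; group
        rw [e]; exact hδ
    exact Subgroup.finiteIndex_of_finite_quotient
  · -- NORMAL in `Γ₀(N)`
    rintro g hg γ ⟨hγ, ν, hν, e⟩
    have hmemg : g * γ * g⁻¹ ∈ Gamma0 N := (Gamma0 N).mul_mem ((Gamma0 N).mul_mem hg hγ) ((Gamma0 N).inv_mem hg)
    refine ⟨hmemg, ν, hν, ?_⟩
    have : (⟨g * γ * g⁻¹, hmemg⟩ : Gamma0 N) = ⟨g, hg⟩ * ⟨γ, hγ⟩ * ⟨g, hg⟩⁻¹ := rfl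
    rw [this, cuspSymbol_mul_holds, cuspSymbol_mul_holds, cuspSymbol_inv, ← e]; ring
  · -- trace `±2` ⟹ zero discriminant ⟹ zero period
    intro γ hγ htr
    refine ⟨hγ, 0, zero_mem _, ?_⟩
    have hdet : ((γ : Matrix (Fin 2) (Fin 2) ℤ)).det = 1 := γ.2
    have hdisc : ((((⟨γ, hγ⟩ : Gamma0 N) : SL(2, ℤ)) : Matrix (Fin 2) (Fin 2) ℤ)).discr = 0 := by
      show ((γ : Matrix (Fin 2) (Fin 2) ℤ)).discr = 0
      rw [Matrix.discr_fin_two, Matrix.trace_fin_two, hdet]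
      rcases htr with h | h <;> rw [h] <;> norm_num
    rw [cuspSymbol_eq_zero_of_discr_eq_zero D.f hdisc]; simp

/-! ## §2 `Γ₁(N) ≤ Γ^{(2)}` is the index-`4` configuration; otherwise `Γ^{(2)}` is noncongruence -/

omit [W.IsElliptic] [W.IsGloballyMinimal] in
/-- For a LATTICE-OPTIMAL datum at `4 ∣ N`: `c·{∞,γ∞}_f ∈ 2Λ_W` for every `γ ∈ Γ₁(N)` ⟺ `Λ₁(f) = 2Λ₀(f)` (index `4`). -/
theorem gamma1_halving_iff_indexFour (D : ModularParametrizationData W N)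
    (hopt : ∀ z ∈ D.L.lattice, ∃ w ∈ periodLattice D.f, z = D.c * w) (h4 : 2 ^ 2 ∣ N) :
    (∀ γ : Gamma1 N, ∃ ν ∈ D.L.lattice,
        (D.c : ℂ) * cuspSymbol D.f ⟨(γ : SL(2, ℤ)), Gamma1_in_Gamma0 N γ.2⟩ = 2 * ν) ↔
      ∀ z : ℂ, z ∈ periodLatticeGamma1 D.f ↔ ∃ w ∈ periodLattice D.f, z = 2 * w := by
  have hc : (D.c : ℂ) ≠ 0 := D.cast_c_ne_zero
  constructor
  · intro h z
    constructor
    · intro hz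
      -- closure induction over the `Γ₁(N)`-symbols generating `Λ₁(f)`
      have key : ∀ z ∈ periodLatticeGamma1 D.f, ∃ ν ∈ D.L.lattice, (D.c : ℂ) * z = 2 * ν := by
        intro z hz
        induction hz using AddSubgroup.closure_induction with
        | mem x hx =>
          obtain ⟨γ, rfl⟩ := hx
          exact h γ
        | zero => exact ⟨0, zero_mem _, by simp⟩
        | add x y _ _ hx hy =>
          obtain ⟨ν₁, hν₁, e₁⟩ := hx
          obtain ⟨ν₂, hν₂, e₂⟩ := hy
          exact ⟨ν₁ + ν₂, add_mem hν₁ hν₂, by rw [mul_add, e₁, e₂]; ring⟩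
        | neg x _ hx =>
          obtain ⟨ν, hν, e⟩ := hx
          exact ⟨-ν, neg_mem hν, by rw [mul_neg, e]; ring⟩
      obtain ⟨ν, hν, e⟩ := key z hz
      obtain ⟨w, hw, hw'⟩ := hopt ν hν
      refine ⟨w, hw, mul_left_cancel₀ hc ?_⟩
      rw [e, hw']; ring
    · rintro ⟨w, hw, rfl⟩
      exact two_mul_mem_periodLatticeGamma1_of_four_dvd D h4 hw
  · intro hidx γ
    have hz := cuspSymbol_mem_periodLatticeGamma1 D.f γ
    obtain ⟨w, hw, hw'⟩ := (hidx _).mp hz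
    exact ⟨(D.c : ℂ) * w, D.smul_periodLattice_le w hw, by rw [hw']; ring⟩

omit [W.IsElliptic] [W.IsGloballyMinimal] in
/-- **The halving cover is NONCONGRUENCE off the index-`4` configuration** (Kurth–Long Prop. 18 = tree `typeIINoncongruence_holds`): for a lattice-optimal
datum at `4 ∣ N` with `Λ₁(f) ≠ 2Λ₀(f)`, no principal congruence subgroup `Γ(M)` lies in `Γ^{(2)}`. [cite: KurthLong2008, Prop. 18] -/
theorem halvingCover_noncongruence (D : ModularParametrizationData W N)
    (hopt : ∀ z ∈ D.L.lattice, ∃ w ∈ periodLattice D.f, z = D.c * w) (h4 : 2 ^ 2 ∣ N)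
    (hidx : ¬ ∀ z : ℂ, z ∈ periodLatticeGamma1 D.f ↔ ∃ w ∈ periodLattice D.f, z = 2 * w)
    {Γ : Subgroup SL(2, ℤ)}
    (hmem : ∀ γ : Gamma0 N, (γ : SL(2, ℤ)) ∈ Γ ↔ ∃ ν ∈ D.L.lattice, (D.c : ℂ) * cuspSymbol D.f γ = 2 * ν)
    (hle : Γ ≤ Gamma0 N) (hfi : Γ.FiniteIndex) (hnorm : ∀ g ∈ Gamma0 N, ∀ γ ∈ Γ, g * γ * g⁻¹ ∈ Γ)
    (htr : ∀ γ ∈ Gamma0 N, (γ 0 0 + γ 1 1 = 2 ∨ γ 0 0 + γ 1 1 = -2) → γ ∈ Γ) :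
    ∀ M : ℕ, 0 < M → ¬ CongruenceSubgroup.Gamma M ≤ Γ := by
  have hN : 0 < N := Nat.pos_of_ne_zero (NeZero.ne N)
  have h1 : ¬ Gamma1 N ≤ Γ := by
    intro h1
    apply hidx
    exact (gamma1_halving_iff_indexFour D hopt h4).mp fun γ ↦ (hmem _).mp (h1 γ.2)
  exact typeIINoncongruence_holds N hN Γ hfi hle hnorm htr h1

/-! ## §3 The UDC glue: a halving witness with algebraic-integer `q`-expansion forces index `4` -/

omit [W.IsElliptic] [W.IsGloballyMinimal] in
/-- **Halving witness ∧ Unbounded Denominators ⟹ index `4`.**  If some holomorphic `F : ℍ → ℂ` of weight `k` has `Γ₀(N)`-stabiliser EXACTLY the halving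
cover group `Γ^{(2)}` (invariant under it; invariance forces membership), exponential growth at every cusp and an algebraic-integer `q`-expansion, then —
modulo `UnboundedDenominatorsWeightAlgInt k` — `Γ^{(2)} ⊇ Γ(MN)` is congruence, hence `Λ₁(f) = 2Λ₀(f)`.  (For a lattice-optimal datum at `4 ∣ N`.)
[cite: CalegariDimitrovTang2025, Thm. 1.0.1] [cite: KurthLong2008, Prop. 18] -/
theorem indexFour_of_halvingWitness_of_UDW (D : ModularParametrizationData W N)
    (hopt : ∀ z ∈ D.L.lattice, ∃ w ∈ periodLattice D.f, z = D.c * w) (h4 : 2 ^ 2 ∣ N) {k : ℤ}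
    (hUDW : UnboundedDenominatorsWeightAlgInt k) {F : UpperHalfPlane → ℂ} (hhol : MDifferentiable 𝓘(ℂ) 𝓘(ℂ) F)
    (hinv : ∀ γ : Gamma0 N, (∃ ν ∈ D.L.lattice, (D.c : ℂ) * cuspSymbol D.f γ = 2 * ν) → F ∣[k] (γ : SL(2, ℤ)) = F)
    (hstab : ∀ γ : Gamma0 N, F ∣[k] (γ : SL(2, ℤ)) = F → ∃ ν ∈ D.L.lattice, (D.c : ℂ) * cuspSymbol D.f γ = 2 * ν)
    (hgrowth : ∀ g : SL(2, ℤ), ∃ C A m : ℝ, ∀ τ : UpperHalfPlane, A ≤ τ.im → ‖(F ∣[k] g) τ‖ ≤ C * Real.exp (m * τ.im))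
    (hq : ∃ b : ℕ → ℂ, (∀ n, IsIntegral ℤ (b n)) ∧ ∀ τ : UpperHalfPlane,
      HasSum (fun n : ℕ ↦ b n * Complex.exp (2 * Real.pi * Complex.I * (τ : ℂ) * n)) (F τ)) :
    ∀ z : ℂ, z ∈ periodLatticeGamma1 D.f ↔ ∃ w ∈ periodLattice D.f, z = 2 * w := by
  obtain ⟨Γ, hmem, hle, hfi, hnorm, htr⟩ := exists_halvingCoverSubgroup D
  have hN : 0 < N := Nat.pos_of_ne_zero (NeZero.ne N)
  have hΓinv : ∀ γ ∈ Γ, F ∣[k] γ = F := by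
    intro γ hγ
    have hγ0 : γ ∈ Gamma0 N := hle hγ
    exact hinv ⟨γ, hγ0⟩ ((hmem ⟨γ, hγ0⟩).mp hγ)
  obtain ⟨M, hM, hcong⟩ := hUDW Γ hfi F hhol hΓinv hgrowth hq
  by_contra hidx
  -- `Γ(MN) ≤ Γ^{(2)}`
  have hΓMN : CongruenceSubgroup.Gamma (M * N) ≤ Γ := by
    intro g hg
    have hgN : g ∈ CongruenceSubgroup.Gamma N := Gamma_mul_le_right M N hg
    have hgM : g ∈ CongruenceSubgroup.Gamma M := Gamma_mul_le_left M N hg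
    have hg0 : g ∈ Gamma0 N := Gamma_le_Gamma0 N hgN
    exact (hmem ⟨g, hg0⟩).mpr (hstab ⟨g, hg0⟩ (hcong g hgM))
  exact halvingCover_noncongruence D hopt h4 hidx hmem hle hfi hnorm htr (M * N) (Nat.mul_pos hM hN) hΓMN

/-! ## §4 The new skeleton's composition: C2 ⟸ CDT ∧ HALVING WITNESS LAW ∧ E-an-152b -/

/-- **C2 for one datum ⟸ CDT ∧ halving witness ∧ index ≠ 4.**  `hHW` is the HALVING WITNESS LAW (OPEN analytic stub; on paper `F = t(½φ)·B_d·f^a·Δ^m`,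
Honda at `c/2`): for every lattice-optimal datum at `4 ∣ N` with `2 ∣ c` a holomorphic weight-`k` witness with `Γ₀(N)`-stabiliser `Γ^{(2)}`, exponential
growth at the cusps and algebraic-integer `q`-expansion. [cite: CalegariDimitrovTang2025, Thm. 1.0.1 and Remarks 58–59] -/
theorem not_two_dvd_maninConstant_of_CDT_of_halvingWitnessLaw_of_indexNeFour
    (hCDT : Literature.NumberTheory.Automorphic.CalegariDimitrovTang2025_unboundedDenominators_algInt)
    (hHW : ∀ (W : WeierstrassCurve ℚ) [W.IsElliptic] [W.IsGloballyMinimal] {N : ℕ} [NeZero N] (D : ModularParametrizationData W N),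
      2 ^ 2 ∣ N → (∀ z ∈ D.L.lattice, ∃ w ∈ periodLattice D.f, z = D.c * w) → (2 : ℤ) ∣ D.c →
      ∃ (k : ℤ) (F : UpperHalfPlane → ℂ), MDifferentiable 𝓘(ℂ) 𝓘(ℂ) F ∧
        (∀ γ : Gamma0 N, (∃ ν ∈ D.L.lattice, (D.c : ℂ) * cuspSymbol D.f γ = 2 * ν) → F ∣[k] (γ : SL(2, ℤ)) = F) ∧
        (∀ γ : Gamma0 N, F ∣[k] (γ : SL(2, ℤ)) = F → ∃ ν ∈ D.L.lattice, (D.c : ℂ) * cuspSymbol D.f γ = 2 * ν) ∧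
        (∀ g : SL(2, ℤ), ∃ C A m : ℝ, ∀ τ : UpperHalfPlane, A ≤ τ.im → ‖(F ∣[k] g) τ‖ ≤ C * Real.exp (m * τ.im)) ∧
        (∃ b : ℕ → ℂ, (∀ n, IsIntegral ℤ (b n)) ∧ ∀ τ : UpperHalfPlane,
          HasSum (fun n : ℕ ↦ b n * Complex.exp (2 * Real.pi * Complex.I * (τ : ℂ) * n)) (F τ)))
    (D : ModularParametrizationData W N) (h4 : 2 ^ 2 ∣ N) (hopt : ∀ z ∈ D.L.lattice, ∃ w ∈ periodLattice D.f, z = D.c * w)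
    (hI4 : ¬ ∀ z : ℂ, z ∈ periodLatticeGamma1 D.f ↔ ∃ w ∈ periodLattice D.f, z = 2 * w) :
    ¬ (2 : ℤ) ∣ D.maninConstant := by
  intro h2c
  obtain ⟨k, F, hhol, hinv, hstab, hgrowth, hq⟩ := hHW W D h4 hopt h2c
  exact hI4 (indexFour_of_halvingWitness_of_UDW D hopt h4 (UDWOfCDT.unboundedDenominatorsWeightAlgInt_of_CDT_algInt hCDT k)
    hhol hinv hstab hgrowth hq)

/-- **THE HALVING SKELETON'S COMPOSITION: C2 `ManinOddAtFour` ⟸ CDT ∧ HALVING WITNESS LAW ∧ E-an-152b `ShimuraIndexNeFourAtFour`.**  The crux's four printed-fact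
binders (Mazur, Abbes–Ullmo, Česnavičius, newform existence) are not used; no Kato fact, no cusp fact, no `2`-torsion or blindness hypothesis.
CONDITIONAL on the three inputs; C2, Manin's conjecture and BSD are not proved by this. [cite: CalegariDimitrovTang2025, Thm. 1.0.1] [cite: KurthLong2008, Prop. 18] -/
theorem maninOddAtFour_of_CDT_halvingWitnessLaw_indexNeFour
    (hCDT : Literature.NumberTheory.Automorphic.CalegariDimitrovTang2025_unboundedDenominators_algInt)
    (hHW : ∀ (W : WeierstrassCurve ℚ) [W.IsElliptic] [W.IsGloballyMinimal] {N : ℕ} [NeZero N] (D : ModularParametrizationData W N),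
      2 ^ 2 ∣ N → (∀ z ∈ D.L.lattice, ∃ w ∈ periodLattice D.f, z = D.c * w) → (2 : ℤ) ∣ D.c →
      ∃ (k : ℤ) (F : UpperHalfPlane → ℂ), MDifferentiable 𝓘(ℂ) 𝓘(ℂ) F ∧
        (∀ γ : Gamma0 N, (∃ ν ∈ D.L.lattice, (D.c : ℂ) * cuspSymbol D.f γ = 2 * ν) → F ∣[k] (γ : SL(2, ℤ)) = F) ∧
        (∀ γ : Gamma0 N, F ∣[k] (γ : SL(2, ℤ)) = F → ∃ ν ∈ D.L.lattice, (D.c : ℂ) * cuspSymbol D.f γ = 2 * ν) ∧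
        (∀ g : SL(2, ℤ), ∃ C A m : ℝ, ∀ τ : UpperHalfPlane, A ≤ τ.im → ‖(F ∣[k] g) τ‖ ≤ C * Real.exp (m * τ.im)) ∧
        (∃ b : ℕ → ℂ, (∀ n, IsIntegral ℤ (b n)) ∧ ∀ τ : UpperHalfPlane,
          HasSum (fun n : ℕ ↦ b n * Complex.exp (2 * Real.pi * Complex.I * (τ : ℂ) * n)) (F τ)))
    (hI4 : ShimuraIndexNeFourAtFour) :
    Summit.BirchSwinnertonDyer.BirchSwinnertonDyer.Theses.ManinLocalTwoThree.ManinOddAtFour := by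
  intro _hM _hAU _hC _hnf W _ _ N _ D hopt h4
  exact not_two_dvd_maninConstant_of_CDT_of_halvingWitnessLaw_of_indexNeFour hCDT hHW D h4 hopt (hI4 W D hopt h4)

end Summit.BirchSwinnertonDyer.BirchSwinnertonDyer.Theorems.ManinLocalTwoThree.Halving

end
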